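import Mathlib
import Summits.KontsevichZagierPeriods.Zeta5Search.ClassTypeGuards
import Summits.KontsevichZagierPeriods.Zeta5Search.T1RayKit
import HarnessLib

/-!
# ζ(5) search — a COVER KIT for the ORIGIN type-space law (`ResidueLaw.typeSpaceLawOrigin_holds`, `casLB + 2`): `OriginWindowClasses` from a class-type cover — DENOM-LAW prover-d1 gen 17

HONEST FRAMING: systematic search; no irrationality claim unless certified.  Cell `pub-zeta5`, track «DENOM-LAW», seat `denom-prover-d1`
gen 17 (`HOME/denom-law/prover-d1/ATTEMPT-17.md`).  `p`-adic valuation bookkeeping for the explicit rationals `Cas_j(b)`; nothing about ζ(5);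
no model exponent moves; records in print UNMOVED.

The ORIGIN-regime type-space law (gen-2 g11; PROVED, p3 gen 2: `typeSpaceLawOrigin_holds`) is consumed in the tree through p3 gen 3's reduction
`OriginWindows.bound_of_classes : OriginWindowClasses b p M D S P ∧ LineData u c D S P ⇒ v_p(Cas_j(b)) ≥ 5 − 2M` (any `b`, any `j`), the
line data being finitely many rational identities decided once per type inventory (`Ray4Windows.lineData8`, `T1Rays.lineData8c`, …).  So far the
class-structure half `OriginWindowClasses` was discharged per window by the p3 atlas machine (`zw_L*` lemmas).  This file is the ALL-`n` tool in
the style of the D1 cover kits (`ClassTypeGuards.casLB_ge_of_cover`, `DenomLaw.clausesL5_of_cover`): a type-level Boolean check of the three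
clauses over a class-type COVER of the residues (`ClassTypeCover.Cover`: every class `IsType b p x T cen` for some listed `(T, cen)`; the check is a
spelled-out `List.all`, no new definition), the transfer theorem `originClasses_of_cover`, the any-`j` window wrapper `originBound_of_classes` (DEG from
`ResidueLaw.sum_classExp_range`) and its universal `M = 8` instance `origin_O8`.  MOTIVATION
(ATTEMPT-17): the one open cell of the TOP linear family `bTop t n` — the `t = 8, 9` sliver `(t+1)n < p ≤ (2t+13)n/3` (node `PathAccountingFirstPeriod`
asks `−11 = casLB + 2`) — is an ORIGIN window at `M = 8` with EXACTLY the tree's universal `M = 8` origin inventory (`Ray4Windows.D8 / S8`,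
`T1Rays.Pc8`, line `u8 = (33, −49)`, `c8 = −174`); the companion files `TopFamilyFPCellsK` / `DenomLaw/TopFamilyFPSliver` prove its cover for all `n`
with this kit.  Valuations of explicit rationals; every model exponent these feed is `< 1`.
-/

open Finset

namespace Summit.KontsevichZagierPeriods.Zeta5Search.DenomLaw

open Summit.KontsevichZagierPeriods.Zeta5Search.ClusterValuation
open Summit.KontsevichZagierPeriods.Zeta5Search.CasoratianValuation (InPolytope shift casoratian)
open Summit.KontsevichZagierPeriods.Zeta5Search.WedgeDictionary (dOf)
open Summit.KontsevichZagierPeriods.Zeta5Search.ClassTypeCover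
open Summit.KontsevichZagierPeriods.Zeta5Search.SecondOrder (classTypeList)
open Summit.KontsevichZagierPeriods.Zeta5Search.OriginWindows (OriginWindowClasses LineData bound_of_classes)
open Summit.KontsevichZagierPeriods.Zeta5Search.ResidueLaw (sum_classExp_range)

variable {p : ℕ}

/-- **`OriginWindowClasses` from a cover** (type-level transfer): if every residue is a typed level class of a type in `TY` and the THREE clauses
hold on the list — every pole type `(T, cen)` has `E ≥ −M`; pole types of exponent `−M` are centre-free with `T ∈ D`; pole types of exponent `−M+1` are
centre-free with `T ∈ S` or (odd `b₀`) centre types with `T ∈ P` (`E = expL odd T cen`, `odd = [b₀ odd]`; a Boolean `List.all`, decided by `decide` on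
explicit lists) — then the origin-window class structure holds for `b` at `(M; D, S, P)`.  (No new definition: the check is spelled out.) -/
theorem originClasses_of_cover [Fact p.Prime] {b : ℕ → ℤ} {TY : List (List ℤ × Bool)} (hcov : Cover b p TY) {M : ℕ}
    {D S P : List (List ℤ)}
    (hchk : (TY.all fun tc =>
      decide (polesL tc.1 = 0) ||
      ((decide (-(M : ℤ) ≤ expL (decide (¬ (2 : ℤ) ∣ b 0)) tc.1 tc.2) &&
        (!decide (expL (decide (¬ (2 : ℤ) ∣ b 0)) tc.1 tc.2 = -(M : ℤ)) || (!tc.2 && decide (tc.1 ∈ D)))) &&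
        (!decide (expL (decide (¬ (2 : ℤ) ∣ b 0)) tc.1 tc.2 = -(M : ℤ) + 1) ||
          ((!tc.2 && decide (tc.1 ∈ S)) || (decide (¬ (2 : ℤ) ∣ b 0) && tc.2 && decide (tc.1 ∈ P)))))) = true) :
    OriginWindowClasses b p M D S P := by
  rw [List.all_eq_true] at hchk
  refine ⟨?_, ?_, ?_⟩
  · intro x hx h1
    obtain ⟨tc, htc, ht⟩ := hcov x hx
    have hc := hchk tc htc
    simp only [Bool.and_eq_true, Bool.or_eq_true, Bool.not_eq_true', decide_eq_false_iff_not, decide_eq_true_eq] at hc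
    rw [ht.classPoleCount_eq] at h1
    rw [ht.classExp_eq]
    rcases hc with h | ⟨⟨h, -⟩, -⟩
    · omega
    · exact h
  · intro x hx h1 hE
    obtain ⟨tc, htc, ht⟩ := hcov x hx
    have hc := hchk tc htc
    simp only [Bool.and_eq_true, Bool.or_eq_true, Bool.not_eq_true', decide_eq_false_iff_not, decide_eq_true_eq] at hc
    rw [ht.classPoleCount_eq] at h1
    rw [ht.classExp_eq] at hE
    rcases hc with h | ⟨⟨-, h | ⟨hc1, hc2⟩⟩, -⟩
    · omega
    · exact absurd hE h
    · refine ⟨fun hcen => ?_, by rw [ht.classTypeList_eq]; exact hc2⟩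
      rw [ht.cen_iff.1 hcen] at hc1
      exact Bool.noConfusion hc1
  · intro y hy h1 hE
    obtain ⟨tc, htc, ht⟩ := hcov y hy
    have hc := hchk tc htc
    simp only [Bool.and_eq_true, Bool.or_eq_true, Bool.not_eq_true', decide_eq_false_iff_not, decide_eq_true_eq] at hc
    rw [ht.classPoleCount_eq] at h1
    rw [ht.classExp_eq] at hE
    rcases hc with h | ⟨-, h | (⟨hc1, hc2⟩ | ⟨⟨ho, hc1⟩, hc2⟩)⟩
    · omega
    · exact absurd hE h
    · left
      refine ⟨fun hcen => ?_, by rw [ht.classTypeList_eq]; exact hc2⟩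
      rw [ht.cen_iff.1 hcen] at hc1
      exact Bool.noConfusion hc1
    · right
      exact ⟨ho, ht.cen_iff.2 hc1, by rw [ht.classTypeList_eq]; exact hc2⟩

/-- **ORIGIN TYPE-SPACE BOUND from the class structure, any direction `j`** (`OriginWindows.bound_of_classes` with the degree condition in the form
`p(M − 2) ≤ 2d(b) + 1`, by `ResidueLaw.sum_classExp_range`): on the polytope with `5 ≤ p ≤ b₀ < p² − 2`, `M ≥ 6` even, a primitive direction
`u ≢ 0 (mod p)` with line data `LineData u c D S P` and the class structure `OriginWindowClasses b p M D S P`: `5 − 2M ≤ v_p(Cas_j(b))`. -/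
theorem originBound_of_classes {b : ℕ → ℤ} {j : ℕ} (hb : InPolytope b) (hb' : InPolytope (shift b j)) (hj1 : 1 ≤ j) (hj7 : j ≤ 7)
    (hpr : p.Prime) (hp5 : 5 ≤ p) (hpb : (p : ℤ) ≤ b 0) (hwin : (b 0 + 2 : ℤ) < (p : ℤ) ^ 2)
    {M : ℕ} (hM : 6 ≤ M) (hMe : Even M) {D S P : List (List ℤ)} {u : ℤ × ℤ} {c : ℚ} (hu : ¬ ((p : ℤ) ∣ u.1 ∧ (p : ℤ) ∣ u.2))
    (hI : LineData u c D S P) (hC : OriginWindowClasses b p M D S P) (hdeg : (p : ℤ) * ((M : ℤ) - 2) ≤ 2 * dOf b + 1)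
    (hcas : casoratian b j ≠ 0) : (5 : ℤ) - 2 * M ≤ padicValRat p (casoratian b j) := by
  haveI : Fact p.Prime := ⟨hpr⟩
  have hdeg' : (p : ℤ) * ((M : ℤ) - 2) + ∑ x ∈ range p, classExp b p x ≤ -4 := by
    rw [sum_classExp_range b hb hp5]; omega
  exact bound_of_classes b j M D S P u c hb hb' hj1 hj7 hp5 hpb hwin hM hMe hu hdeg' hC hI hcas

/-- **The universal `M = 8` instance** (the tree's origin inventory `Ray4Windows.D8 / S8` with the odd-centre type `T1Rays.Pc8`, line `u8 = (33, −49)`,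
`c8 = −174`; line data `T1Rays.lineData8c` PROVED, `Ray4Windows.u8_ne`): the class structure at `(8; D8, S8, Pc8)` and `6p ≤ 2d(b) + 1` give
`−11 ≤ v_p(Cas_j(b))` for every admissible direction `j`. -/
theorem origin_O8 {b : ℕ → ℤ} {j : ℕ} (hb : InPolytope b) (hb' : InPolytope (shift b j)) (hj1 : 1 ≤ j) (hj7 : j ≤ 7)
    (hpr : p.Prime) (hp5 : 5 ≤ p) (hpb : (p : ℤ) ≤ b 0) (hwin : (b 0 + 2 : ℤ) < (p : ℤ) ^ 2)
    (hC : OriginWindowClasses b p 8 Ray4Windows.D8 Ray4Windows.S8 T1Rays.Pc8)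
    (hdeg : (p : ℤ) * 6 ≤ 2 * dOf b + 1) (hcas : casoratian b j ≠ 0) : (-11 : ℤ) ≤ padicValRat p (casoratian b j) := by
  have h := originBound_of_classes hb hb' hj1 hj7 hpr hp5 hpb hwin (M := 8) (by norm_num) (by decide) (Ray4Windows.u8_ne hpr) T1Rays.lineData8c hC
    (by simpa using hdeg) hcas
  simpa using h

/-- Sanity of the spelled-out check on the universal `M = 8` inventory (the TOP sliver's type list for `t = 9`, `n` odd: the odd-centre sub-deep class
passes through `Pc8`). -/
example : ([([1, -6, -4, 1], false), ([1, -5, -5, 1], false), ([1, -4, -6, 1], false), ([1, -6, -3, 1], false),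
      ([1, -5, -5, 1], true), ([1, -6, 1], false), ([1, 1], false), ([0, -5, -2, 1], false)] : List (List ℤ × Bool)).all (fun tc =>
      decide (polesL tc.1 = 0) ||
      ((decide (-((8 : ℕ) : ℤ) ≤ expL true tc.1 tc.2) &&
        (!decide (expL true tc.1 tc.2 = -((8 : ℕ) : ℤ)) || (!tc.2 && decide (tc.1 ∈ Ray4Windows.D8)))) &&
        (!decide (expL true tc.1 tc.2 = -((8 : ℕ) : ℤ) + 1) ||
          ((!tc.2 && decide (tc.1 ∈ Ray4Windows.S8)) || (true && tc.2 && decide (tc.1 ∈ T1Rays.Pc8)))))) = true := by decide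

end Summit.KontsevichZagierPeriods.Zeta5Search.DenomLaw
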